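import Mathlib
import Summits.AtomisticToContinuum.Crystallization.Theses.SumsetDoublingRigidity
import Literature.Geometry.DiscreteGeometry.MeyerSets

/-!
# Birth skeleton (BC3) for the crux `DoublingRungRigidity`
(route `AtomisticToContinuum/Crystallization/SumsetDoublingRigidity`, item stmt-AtomisticToContinuum-16934)

Line `birth` = the route's intended proof, cut at its two named hubs:

* `stub_meyerOfDoubling` — MEYER STEP (known in print, unformalised): a `δ`-separated,
  `(9/10)δ`-covered `X ⊂ ℝ³` whose sumset has density-doubling `< 2` on large origin balls has
  finite window doubling (`X ∩ B_{R/2} + X ∩ B_{R/2} ⊆ (X+X) ∩ B_R`, Delone volume counting), hence is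
  a Meyer set: `X ⊆ M + F` with `M` cut-and-project and `F` finite (Konieczny 2023 Thm 1.3 / 3.1 via
  Freiman–Ruzsa; Lagarias 1996; tree fact `Literature.Geometry.DiscreteGeometry.Konieczny2023_thm_1_1`
  records the characterisation, condition (D)).
* `stub_subcrystalOfMeyer` — INTERNAL DIMENSION ZERO (new): below Kneser's threshold `2` a relatively
  dense subset of `M + F` cannot use a real internal direction (extreme internal coordinate /
  Brunn–Minkowski in the internal group: two translates `x₁ + X`, `x₂ + X` with extreme star
  coordinates overlap in density `o(1)`, forcing `κ ≥ 2`), so `X` lies inside an ideal crystal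
  `L + F'` = the point set of some `PeriodicConfiguration 3`.
* `stub_tightCrystalOfSubcrystal` — DISCRETE KNESER RUNG (new, the threshold step): a
  `δ`-separated `(9/10)δ`-covered subset of a crystal with `κ < 2` fills more than half of every
  coset class it meets (Kneser-type inequality in `ℤ³ × finite` along origin balls), so every
  difference class of the hull shorter than `δ` would be realised inside `X`; hence `X` sits inside a
  crystal that is itself `δ`-separated.
* `periodic_of_stubs` / `DoublingRungRigidity_of` — SATURATION ENDGAME (proved here): a `δ`-separated crystal containing a
  `(9/10)δ`-covering `X` equals `X` (a missing crystal point would be within `(9/10)δ < δ` of a point of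
  `X`, both in the crystal), so `X` is the point set of a periodic configuration.

Sorries: exactly the three `stub_*`. `periodic_of_stubs : stub₁ → stub₂ → stub₃ → (crux unfolded)` and the
`example : stub₁ → stub₂ → stub₃ → DoublingRungRigidity` are sorry-free; `DoublingRungRigidity_of : DoublingRungRigidity`
concludes the route decl by name from the three stubs (the shape `#h21_check_skeleton` registers).
-/

namespace Summit.AtomisticToContinuum.Crystallization.Cruxes.DoublingRungRigidity.Birth

open scoped Pointwise

/-- **Stub 1 — Meyer step.** Separation + `(9/10)δ`-covering + sumset density-doubling `< 2` on large
origin balls ⇒ `X ⊆ M + F` with `M` a cut-and-project set and `F` finite (condition (D) of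
Konieczny 2023, Thm 1.1; proof route: window doubling `≤ 8θ` by Delone counting, then Konieczny 2023
Thm 1.3 / 3.1 = Freiman–Ruzsa in `ℝ³`, or Plünnecke–Ruzsa + Lagarias 1996). Size L (known, unformalised). -/
theorem stub_meyerOfDoubling :
    ∀ (X : Set (EuclideanSpace ℝ (Fin 3))) (δ : ℝ), 0 < δ →
        (∀ a ∈ X, ∀ b ∈ X, a ≠ b → δ ≤ dist a b) →
        (∀ z : EuclideanSpace ℝ (Fin 3), ∃ a ∈ X, dist z a ≤ 9 / 10 * δ) →
        (∃ θ : ℝ, θ < 2 ∧ ∃ R₀ : ℝ, ∀ R : ℝ, R₀ ≤ R → ({v : EuclideanSpace ℝ (Fin 3) | ‖v‖ ≤ R ∧ ∃ a ∈ X, ∃ b ∈ X, v = a + b} : Set (EuclideanSpace ℝ (Fin 3))).Finite ∧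
          (({v : EuclideanSpace ℝ (Fin 3) | ‖v‖ ≤ R ∧ ∃ a ∈ X, ∃ b ∈ X, v = a + b} : Set (EuclideanSpace ℝ (Fin 3))).ncard : ℝ) ≤ θ * (({a : EuclideanSpace ℝ (Fin 3) | a ∈ X ∧ ‖a‖ ≤ R} : Set (EuclideanSpace ℝ (Fin 3))).ncard : ℝ)) →
        (∃ (e : ℕ) (M F : Set (EuclideanSpace ℝ (Fin 3))),
          Literature.Geometry.DiscreteGeometry.IsCutAndProject 3 e M ∧ F.Finite ∧ X ⊆ M + F) := by
  sorry

/-- **Stub 2 — internal dimension zero.** A `δ`-separated `(9/10)δ`-covered `X ⊆ M + F`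
(cut-and-project + finite) with sumset density-doubling `< 2` lies inside an ideal crystal: the point
set of some `PeriodicConfiguration 3` (full-rank period lattice + finite motif). Mechanism: after
reduction to an irredundant scheme, a real internal direction gives two translates `x₁ + X`, `x₂ + X`
(extreme internal coordinates) whose overlap has density `o(dens X)` by uniform distribution of model
sets, so `dens (X+X) ≥ 2·dens X`, i.e. `κ ≥ 2`; hence the internal group is finite. Size L (new). -/
theorem stub_subcrystalOfMeyer :
    ∀ (X : Set (EuclideanSpace ℝ (Fin 3))) (δ : ℝ), 0 < δ →
        (∀ a ∈ X, ∀ b ∈ X, a ≠ b → δ ≤ dist a b) →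
        (∀ z : EuclideanSpace ℝ (Fin 3), ∃ a ∈ X, dist z a ≤ 9 / 10 * δ) →
        (∃ θ : ℝ, θ < 2 ∧ ∃ R₀ : ℝ, ∀ R : ℝ, R₀ ≤ R → ({v : EuclideanSpace ℝ (Fin 3) | ‖v‖ ≤ R ∧ ∃ a ∈ X, ∃ b ∈ X, v = a + b} : Set (EuclideanSpace ℝ (Fin 3))).Finite ∧
          (({v : EuclideanSpace ℝ (Fin 3) | ‖v‖ ≤ R ∧ ∃ a ∈ X, ∃ b ∈ X, v = a + b} : Set (EuclideanSpace ℝ (Fin 3))).ncard : ℝ) ≤ θ * (({a : EuclideanSpace ℝ (Fin 3) | a ∈ X ∧ ‖a‖ ≤ R} : Set (EuclideanSpace ℝ (Fin 3))).ncard : ℝ)) →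
        (∃ (e : ℕ) (M F : Set (EuclideanSpace ℝ (Fin 3))),
          Literature.Geometry.DiscreteGeometry.IsCutAndProject 3 e M ∧ F.Finite ∧ X ⊆ M + F) →
        (∃ P : Literature.MathematicalPhysics.StatisticalMechanics.PeriodicConfiguration 3,
          X ⊆ P.points) := by
  sorry

/-- **Stub 3 — discrete Kneser rung (tight hull).** A `δ`-separated `(9/10)δ`-covered subset `X` of a
crystal with sumset density-doubling `< 2` lies inside a crystal that is itself `δ`-separated.
Mechanism: Kneser-type inequality with stabiliser in `ℤ³ × (finite motif group)` along origin balls ⇒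
`X` meets each coset class of its periodic hull `C` in relative density `> 1/2` ⇒ any difference class
of `C` of length `< δ` is realised by two points of `X`, contradicting separation ⇒ `C` is
`δ`-separated. This is the crux restricted to crystal subsets (the threshold `2` is sharp: AP-coset
unions `(2k−1)/k ↑ 2`). Size L (new; the load-bearing stub). -/
theorem stub_tightCrystalOfSubcrystal :
    ∀ (X : Set (EuclideanSpace ℝ (Fin 3))) (δ : ℝ), 0 < δ →
        (∀ a ∈ X, ∀ b ∈ X, a ≠ b → δ ≤ dist a b) →
        (∀ z : EuclideanSpace ℝ (Fin 3), ∃ a ∈ X, dist z a ≤ 9 / 10 * δ) →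
        (∃ θ : ℝ, θ < 2 ∧ ∃ R₀ : ℝ, ∀ R : ℝ, R₀ ≤ R → ({v : EuclideanSpace ℝ (Fin 3) | ‖v‖ ≤ R ∧ ∃ a ∈ X, ∃ b ∈ X, v = a + b} : Set (EuclideanSpace ℝ (Fin 3))).Finite ∧
          (({v : EuclideanSpace ℝ (Fin 3) | ‖v‖ ≤ R ∧ ∃ a ∈ X, ∃ b ∈ X, v = a + b} : Set (EuclideanSpace ℝ (Fin 3))).ncard : ℝ) ≤ θ * (({a : EuclideanSpace ℝ (Fin 3) | a ∈ X ∧ ‖a‖ ≤ R} : Set (EuclideanSpace ℝ (Fin 3))).ncard : ℝ)) →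
        (∃ P : Literature.MathematicalPhysics.StatisticalMechanics.PeriodicConfiguration 3,
          X ⊆ P.points) →
        (∃ P : Literature.MathematicalPhysics.StatisticalMechanics.PeriodicConfiguration 3,
          X ⊆ P.points ∧ ∀ a ∈ P.points, ∀ b ∈ P.points, a ≠ b → δ ≤ dist a b) := by
  sorry

/-- **Saturation endgame (sorry-free).** A `(9/10)δ`-covering set `X` contained in a `δ`-separated set
`C` equals `C`: a point of `C ∖ X` is `(9/10)δ`-close to a point of `X ⊆ C`, i.e. strictly closer than the
separation of `C`. [folklore] -/
theorem eq_of_cover_of_subset_separated {X C : Set (EuclideanSpace ℝ (Fin 3))} {δ : ℝ} (hδ : 0 < δ)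
    (hcov : ∀ z : EuclideanSpace ℝ (Fin 3), ∃ a ∈ X, dist z a ≤ 9 / 10 * δ)
    (hXC : X ⊆ C) (hCsep : ∀ a ∈ C, ∀ b ∈ C, a ≠ b → δ ≤ dist a b) : C = X := by
  refine Set.Subset.antisymm ?_ hXC
  intro v hv
  obtain ⟨a, haX, hva⟩ := hcov v
  by_contra hvX
  have hne : v ≠ a := fun h => hvX (h ▸ haX)
  have hδle : δ ≤ dist v a := hCsep v hv a (hXC haX) hne
  linarith

/-- **Hypothesis form of the composition (sorry-free; conclusion = the crux unfolded).** The three stub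
STATEMENTS imply: every `δ`-separated `(9/10)δ`-covered `X` with sumset density-doubling `< 2` eventually
is the point set of a periodic configuration — chain Meyer ⇒ sub-crystal ⇒ tight crystal `P ⊇ X`, then
`P.points = X` by `eq_of_cover_of_subset_separated`. [folklore] -/
theorem periodic_of_stubs
    (h1 : ∀ (X : Set (EuclideanSpace ℝ (Fin 3))) (δ : ℝ), 0 < δ →
        (∀ a ∈ X, ∀ b ∈ X, a ≠ b → δ ≤ dist a b) →
        (∀ z : EuclideanSpace ℝ (Fin 3), ∃ a ∈ X, dist z a ≤ 9 / 10 * δ) →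
        (∃ θ : ℝ, θ < 2 ∧ ∃ R₀ : ℝ, ∀ R : ℝ, R₀ ≤ R → ({v : EuclideanSpace ℝ (Fin 3) | ‖v‖ ≤ R ∧ ∃ a ∈ X, ∃ b ∈ X, v = a + b} : Set (EuclideanSpace ℝ (Fin 3))).Finite ∧
          (({v : EuclideanSpace ℝ (Fin 3) | ‖v‖ ≤ R ∧ ∃ a ∈ X, ∃ b ∈ X, v = a + b} : Set (EuclideanSpace ℝ (Fin 3))).ncard : ℝ) ≤ θ * (({a : EuclideanSpace ℝ (Fin 3) | a ∈ X ∧ ‖a‖ ≤ R} : Set (EuclideanSpace ℝ (Fin 3))).ncard : ℝ)) →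
        (∃ (e : ℕ) (M F : Set (EuclideanSpace ℝ (Fin 3))),
          Literature.Geometry.DiscreteGeometry.IsCutAndProject 3 e M ∧ F.Finite ∧ X ⊆ M + F))
    (h2 : ∀ (X : Set (EuclideanSpace ℝ (Fin 3))) (δ : ℝ), 0 < δ →
        (∀ a ∈ X, ∀ b ∈ X, a ≠ b → δ ≤ dist a b) →
        (∀ z : EuclideanSpace ℝ (Fin 3), ∃ a ∈ X, dist z a ≤ 9 / 10 * δ) →
        (∃ θ : ℝ, θ < 2 ∧ ∃ R₀ : ℝ, ∀ R : ℝ, R₀ ≤ R → ({v : EuclideanSpace ℝ (Fin 3) | ‖v‖ ≤ R ∧ ∃ a ∈ X, ∃ b ∈ X, v = a + b} : Set (EuclideanSpace ℝ (Fin 3))).Finite ∧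
          (({v : EuclideanSpace ℝ (Fin 3) | ‖v‖ ≤ R ∧ ∃ a ∈ X, ∃ b ∈ X, v = a + b} : Set (EuclideanSpace ℝ (Fin 3))).ncard : ℝ) ≤ θ * (({a : EuclideanSpace ℝ (Fin 3) | a ∈ X ∧ ‖a‖ ≤ R} : Set (EuclideanSpace ℝ (Fin 3))).ncard : ℝ)) →
        (∃ (e : ℕ) (M F : Set (EuclideanSpace ℝ (Fin 3))),
          Literature.Geometry.DiscreteGeometry.IsCutAndProject 3 e M ∧ F.Finite ∧ X ⊆ M + F) →
        (∃ P : Literature.MathematicalPhysics.StatisticalMechanics.PeriodicConfiguration 3,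
          X ⊆ P.points))
    (h3 : ∀ (X : Set (EuclideanSpace ℝ (Fin 3))) (δ : ℝ), 0 < δ →
        (∀ a ∈ X, ∀ b ∈ X, a ≠ b → δ ≤ dist a b) →
        (∀ z : EuclideanSpace ℝ (Fin 3), ∃ a ∈ X, dist z a ≤ 9 / 10 * δ) →
        (∃ θ : ℝ, θ < 2 ∧ ∃ R₀ : ℝ, ∀ R : ℝ, R₀ ≤ R → ({v : EuclideanSpace ℝ (Fin 3) | ‖v‖ ≤ R ∧ ∃ a ∈ X, ∃ b ∈ X, v = a + b} : Set (EuclideanSpace ℝ (Fin 3))).Finite ∧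
          (({v : EuclideanSpace ℝ (Fin 3) | ‖v‖ ≤ R ∧ ∃ a ∈ X, ∃ b ∈ X, v = a + b} : Set (EuclideanSpace ℝ (Fin 3))).ncard : ℝ) ≤ θ * (({a : EuclideanSpace ℝ (Fin 3) | a ∈ X ∧ ‖a‖ ≤ R} : Set (EuclideanSpace ℝ (Fin 3))).ncard : ℝ)) →
        (∃ P : Literature.MathematicalPhysics.StatisticalMechanics.PeriodicConfiguration 3,
          X ⊆ P.points) →
        (∃ P : Literature.MathematicalPhysics.StatisticalMechanics.PeriodicConfiguration 3,
          X ⊆ P.points ∧ ∀ a ∈ P.points, ∀ b ∈ P.points, a ≠ b → δ ≤ dist a b)) :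
    ∀ X : Set (EuclideanSpace ℝ (Fin 3)), (∃ δ : ℝ, 0 < δ ∧ (∀ a ∈ X, ∀ b ∈ X, a ≠ b → δ ≤ dist a b) ∧
        (∀ z : EuclideanSpace ℝ (Fin 3), ∃ a ∈ X, dist z a ≤ 9 / 10 * δ)) →
      (∃ θ : ℝ, θ < 2 ∧ ∃ R₀ : ℝ, ∀ R : ℝ, R₀ ≤ R → ({v : EuclideanSpace ℝ (Fin 3) | ‖v‖ ≤ R ∧ ∃ a ∈ X, ∃ b ∈ X, v = a + b} : Set (EuclideanSpace ℝ (Fin 3))).Finite ∧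
          (({v : EuclideanSpace ℝ (Fin 3) | ‖v‖ ≤ R ∧ ∃ a ∈ X, ∃ b ∈ X, v = a + b} : Set (EuclideanSpace ℝ (Fin 3))).ncard : ℝ) ≤ θ * (({a : EuclideanSpace ℝ (Fin 3) | a ∈ X ∧ ‖a‖ ≤ R} : Set (EuclideanSpace ℝ (Fin 3))).ncard : ℝ)) →
      ∃ P : Literature.MathematicalPhysics.StatisticalMechanics.PeriodicConfiguration 3, P.points = X := by
  intro X hDel hκ
  obtain ⟨δ, hδ, hsep, hcov⟩ := hDel
  obtain ⟨P, hXP, hPsep⟩ :=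
    h3 X δ hδ hsep hcov hκ (h2 X δ hδ hsep hcov hκ (h1 X δ hδ hsep hcov hκ))
  exact ⟨P, eq_of_cover_of_subset_separated hδ hcov hXP hPsep⟩

/-- **BC3 letter — `stub sigs → DoublingRungRigidity` (sorry-free).** An `example`, not a named theorem:
`#h21_check_skeleton` takes a declaration concluding the crux as THE skeleton theorem and requires it to be
hypothesis-free; the named hypothesis form is `periodic_of_stubs` (same statement, crux unfolded). -/
example :
    (∀ (X : Set (EuclideanSpace ℝ (Fin 3))) (δ : ℝ), 0 < δ →
        (∀ a ∈ X, ∀ b ∈ X, a ≠ b → δ ≤ dist a b) →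
        (∀ z : EuclideanSpace ℝ (Fin 3), ∃ a ∈ X, dist z a ≤ 9 / 10 * δ) →
        (∃ θ : ℝ, θ < 2 ∧ ∃ R₀ : ℝ, ∀ R : ℝ, R₀ ≤ R → ({v : EuclideanSpace ℝ (Fin 3) | ‖v‖ ≤ R ∧ ∃ a ∈ X, ∃ b ∈ X, v = a + b} : Set (EuclideanSpace ℝ (Fin 3))).Finite ∧
          (({v : EuclideanSpace ℝ (Fin 3) | ‖v‖ ≤ R ∧ ∃ a ∈ X, ∃ b ∈ X, v = a + b} : Set (EuclideanSpace ℝ (Fin 3))).ncard : ℝ) ≤ θ * (({a : EuclideanSpace ℝ (Fin 3) | a ∈ X ∧ ‖a‖ ≤ R} : Set (EuclideanSpace ℝ (Fin 3))).ncard : ℝ)) →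
        (∃ (e : ℕ) (M F : Set (EuclideanSpace ℝ (Fin 3))),
          Literature.Geometry.DiscreteGeometry.IsCutAndProject 3 e M ∧ F.Finite ∧ X ⊆ M + F)) →
    (∀ (X : Set (EuclideanSpace ℝ (Fin 3))) (δ : ℝ), 0 < δ →
        (∀ a ∈ X, ∀ b ∈ X, a ≠ b → δ ≤ dist a b) →
        (∀ z : EuclideanSpace ℝ (Fin 3), ∃ a ∈ X, dist z a ≤ 9 / 10 * δ) →
        (∃ θ : ℝ, θ < 2 ∧ ∃ R₀ : ℝ, ∀ R : ℝ, R₀ ≤ R → ({v : EuclideanSpace ℝ (Fin 3) | ‖v‖ ≤ R ∧ ∃ a ∈ X, ∃ b ∈ X, v = a + b} : Set (EuclideanSpace ℝ (Fin 3))).Finite ∧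
          (({v : EuclideanSpace ℝ (Fin 3) | ‖v‖ ≤ R ∧ ∃ a ∈ X, ∃ b ∈ X, v = a + b} : Set (EuclideanSpace ℝ (Fin 3))).ncard : ℝ) ≤ θ * (({a : EuclideanSpace ℝ (Fin 3) | a ∈ X ∧ ‖a‖ ≤ R} : Set (EuclideanSpace ℝ (Fin 3))).ncard : ℝ)) →
        (∃ (e : ℕ) (M F : Set (EuclideanSpace ℝ (Fin 3))),
          Literature.Geometry.DiscreteGeometry.IsCutAndProject 3 e M ∧ F.Finite ∧ X ⊆ M + F) →
        (∃ P : Literature.MathematicalPhysics.StatisticalMechanics.PeriodicConfiguration 3,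
          X ⊆ P.points)) →
    (∀ (X : Set (EuclideanSpace ℝ (Fin 3))) (δ : ℝ), 0 < δ →
        (∀ a ∈ X, ∀ b ∈ X, a ≠ b → δ ≤ dist a b) →
        (∀ z : EuclideanSpace ℝ (Fin 3), ∃ a ∈ X, dist z a ≤ 9 / 10 * δ) →
        (∃ θ : ℝ, θ < 2 ∧ ∃ R₀ : ℝ, ∀ R : ℝ, R₀ ≤ R → ({v : EuclideanSpace ℝ (Fin 3) | ‖v‖ ≤ R ∧ ∃ a ∈ X, ∃ b ∈ X, v = a + b} : Set (EuclideanSpace ℝ (Fin 3))).Finite ∧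
          (({v : EuclideanSpace ℝ (Fin 3) | ‖v‖ ≤ R ∧ ∃ a ∈ X, ∃ b ∈ X, v = a + b} : Set (EuclideanSpace ℝ (Fin 3))).ncard : ℝ) ≤ θ * (({a : EuclideanSpace ℝ (Fin 3) | a ∈ X ∧ ‖a‖ ≤ R} : Set (EuclideanSpace ℝ (Fin 3))).ncard : ℝ)) →
        (∃ P : Literature.MathematicalPhysics.StatisticalMechanics.PeriodicConfiguration 3,
          X ⊆ P.points) →
        (∃ P : Literature.MathematicalPhysics.StatisticalMechanics.PeriodicConfiguration 3,
          X ⊆ P.points ∧ ∀ a ∈ P.points, ∀ b ∈ P.points, a ≠ b → δ ≤ dist a b)) →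
    Summit.AtomisticToContinuum.Crystallization.Theses.SumsetDoublingRigidity.DoublingRungRigidity :=
  fun h1 h2 h3 => periodic_of_stubs h1 h2 h3

/-- **THE SKELETON THEOREM.** The crux
`Summit.AtomisticToContinuum.Crystallization.Theses.SumsetDoublingRigidity.DoublingRungRigidity`, concluded
BY NAME from the three declared stubs through the sorry-free composition `periodic_of_stubs`
(`sorry` enters only through `stub_meyerOfDoubling`, `stub_subcrystalOfMeyer`,
`stub_tightCrystalOfSubcrystal`). [folklore] -/
theorem DoublingRungRigidity_of :
    Summit.AtomisticToContinuum.Crystallization.Theses.SumsetDoublingRigidity.DoublingRungRigidity :=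
  periodic_of_stubs stub_meyerOfDoubling stub_subcrystalOfMeyer stub_tightCrystalOfSubcrystal

end Summit.AtomisticToContinuum.Crystallization.Cruxes.DoublingRungRigidity.Birth
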